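import Mathlib
import HarnessLib
import Summits.HodgeConjecture.HodgeConjecture.Theses.KleimanBFSeeds
import Literature.AlgebraicGeometry.HodgeTheory.ChernCharacterBetti
import Literature.AlgebraicGeometry.HodgeTheory.ChernCharacterBettiSums
import Literature.AlgebraicGeometry.HodgeTheory.KleimanChernNormalForm
import Literature.AlgebraicGeometry.KTheory.GrothendieckGroup

/-!
# Stub `stub_effectivise` of the birth skeleton of crux `KleimanChernCharacterOnBetti`
(stmt-HodgeConjecture-26526, route `KleimanBFSeeds`) — effectivisation of a virtual normal form

HONEST FRAMING: a bookkeeping HELPER (`--supports stmt-HodgeConjecture-26526`), valid for EVERY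
hypothesis structure `C : ChernCharacterBetti`; it does NOT construct a Chern character on Betti
cohomology (the load-bearing stub `stub_virtualComplements` of the skeleton
`Cruxes/KleimanChernCharacterOnBetti/Lines/birth.lean` stays open), and proves nothing toward the
crux K-C⁺ by itself, nor toward K2, H2, HC_AV, HC_CM or HC.

Statement (the registered stub, verbatim): for every `C`, IF (SVNF) every rational algebraic class
`x` of codimension `p ≥ 1` on a smooth projective `X ⊆ ℙᴺ` (`h = e^*a`) is, up to `ℚ·hᵖ` and a
factor `N ≠ 0`, the degree-`p` Chern character of a VIRTUAL combination `Σ[E ∈ Lp] − Σ[F ∈ Lm]` of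
finite locally free modules with `chᵢ ∈ ℚ·hⁱ` for `0 < i < p`, AND (HTC) every finite locally free
`F` has a finite locally free h-trivial complement `K` (`chᵢ(F) + chᵢ(K) ∈ ℚ·hⁱ`, `i ≥ 1`), THEN `C`
has Kleiman's normal form `C.KleimanChernNormalForm` (Literature, p610489).

Proof: replace every negative term `−[F]` by `+[K_F]` and take the list direct sum
`E := ⊕_{Lp} E ⊕ ⊕_{F ∈ Lm} K_F ⊕ 0`; it is finite locally free
(`isFiniteLocallyFree_foldr_biprod`) and by Whitney on the list (`ChernCharacterBetti.ch_foldr_biprod`)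
`chᵢ(E) = (Σ⁺ − Σ⁻)ᵢ + (Σ_F r_{F,i})·hⁱ` for every `i ≥ 1`, i.e. the virtual value shifted along
the `h`-line by a RATIONAL amount. [cite: Fulton1998, Example 3.2.3 and Example 15.3.2]
-/

-- every declaration of this problem lives in `Summit.HodgeConjecture.HodgeConjecture.…` (summit = sub-problem)
set_option linter.dupNamespace false

noncomputable section

open CategoryTheory CategoryTheory.Limits
open scoped ZeroObject

namespace Summit.HodgeConjecture.HodgeConjecture.Theorems.KleimanChernCharacterOnBettiBirth

/-- **Effectivisation of a sum-normalised virtual normal form by h-trivial complements** (stub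
`stub_effectivise` of `Cruxes/KleimanChernCharacterOnBetti/Lines/birth.lean`, registered signature
verbatim): (SVNF) ∧ (HTC) ⟹ Kleiman's normal form, for every `C : ChernCharacterBetti`.
[cite: Fulton1998, Example 3.2.3 and Example 15.3.2] -/
theorem stub_effectivise :
    ∀ C : Literature.AlgebraicGeometry.HodgeTheory.ChernCharacterBetti,
    (∀ ⦃n : ℕ⦄ ⦃X : Literature.AlgebraicGeometry.Motives.SchemeOver ℂ⦄, Literature.AlgebraicGeometry.Motives.IsSmoothProjective n X →
      ∀ (e : Literature.AlgebraicGeometry.Motives.ProjectiveEmbedding X) (a : Literature.AlgebraicGeometry.HodgeTheory.complexBetti (Literature.AlgebraicGeometry.Motives.projectiveSpace e.n ℂ) 2),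
        Literature.AlgebraicGeometry.HodgeTheory.IsRationalClass a → a ≠ 0 →
        ∀ ⦃p : ℕ⦄, 0 < p → ∀ ⦃x : Literature.AlgebraicGeometry.HodgeTheory.complexBetti X (2 * p)⦄, Literature.AlgebraicGeometry.HodgeTheory.IsRationalClass x →
          x ∈ Literature.AlgebraicGeometry.HodgeTheory.algebraicClasses X p →
          ∃ (Lp Lm : List X.left.Modules) (q N : ℚ) (c : ℕ → ℚ),
            (∀ E ∈ Lp, Literature.AlgebraicGeometry.Motives.IsFiniteLocallyFree E) ∧ (∀ F ∈ Lm, Literature.AlgebraicGeometry.Motives.IsFiniteLocallyFree F) ∧ N ≠ 0 ∧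
            (Lp.map fun E => C.ch X E p).sum - (Lm.map fun F => C.ch X F p).sum =
              (q : ℂ) • Literature.AlgebraicGeometry.HodgeTheory.cupPowTwo (Literature.AlgebraicGeometry.HodgeTheory.complexBetti.map e.ι 2 a) p + (N : ℂ) • x ∧
            ∀ i : ℕ, 0 < i → i < p →
              (Lp.map fun E => C.ch X E i).sum - (Lm.map fun F => C.ch X F i).sum =
                (c i : ℂ) • Literature.AlgebraicGeometry.HodgeTheory.cupPowTwo (Literature.AlgebraicGeometry.HodgeTheory.complexBetti.map e.ι 2 a) i) →
    (∀ ⦃n : ℕ⦄ ⦃X : Literature.AlgebraicGeometry.Motives.SchemeOver ℂ⦄, Literature.AlgebraicGeometry.Motives.IsSmoothProjective n X →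
      ∀ (e : Literature.AlgebraicGeometry.Motives.ProjectiveEmbedding X) (a : Literature.AlgebraicGeometry.HodgeTheory.complexBetti (Literature.AlgebraicGeometry.Motives.projectiveSpace e.n ℂ) 2),
        Literature.AlgebraicGeometry.HodgeTheory.IsRationalClass a → a ≠ 0 →
        ∀ (E : X.left.Modules), Literature.AlgebraicGeometry.Motives.IsFiniteLocallyFree E →
          ∃ K : X.left.Modules, Literature.AlgebraicGeometry.Motives.IsFiniteLocallyFree K ∧
            ∀ i : ℕ, 0 < i → ∃ r : ℚ, C.ch X E i + C.ch X K i =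
              (r : ℂ) • Literature.AlgebraicGeometry.HodgeTheory.cupPowTwo (Literature.AlgebraicGeometry.HodgeTheory.complexBetti.map e.ι 2 a) i) →
    C.KleimanChernNormalForm := by
  intro C hS hH n X hX e a ha ha0 p hp x hx hxalg
  classical
  obtain ⟨Lp, Lm, q, N, c, hLp, hLm, hN, hchp, hchi⟩ := hS hX e a ha ha0 hp hx hxalg
  -- h-trivial complements of the negative terms
  have hK : ∀ F ∈ Lm, ∃ K : X.left.Modules, Literature.AlgebraicGeometry.Motives.IsFiniteLocallyFree K ∧
      ∀ i : ℕ, 0 < i → ∃ r : ℚ, C.ch X F i + C.ch X K i =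
        (r : ℂ) • Literature.AlgebraicGeometry.HodgeTheory.cupPowTwo
          (Literature.AlgebraicGeometry.HodgeTheory.complexBetti.map e.ι 2 a) i :=
    fun F hF => hH hX e a ha ha0 F (hLm F hF)
  haveI : Nonempty X.left.Modules := ⟨0⟩
  choose! K hKf hKr using hK
  choose! r hr using hKr
  -- the effective module `⊕ Lp ⊕ ⊕ K(Lm) ⊕ 0`
  set h := Literature.AlgebraicGeometry.HodgeTheory.complexBetti.map e.ι 2 a with hh
  set L : List X.left.Modules := Lp ++ Lm.map K with hL
  have hLf : ∀ E ∈ L, Literature.AlgebraicGeometry.Motives.IsFiniteLocallyFree E := by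
    intro E hE
    rcases List.mem_append.1 hE with hE | hE
    · exact hLp E hE
    · obtain ⟨F, hF, rfl⟩ := List.mem_map.1 hE
      exact hKf F hF
  have hZ : Literature.AlgebraicGeometry.Motives.IsFiniteLocallyFree (0 : X.left.Modules) :=
    Literature.AlgebraicGeometry.KTheory.KZero.isFiniteLocallyFree_of_isZero (isZero_zero _)
  -- `chᵢ` of the effective module, `i ≥ 1`: the virtual value plus a rational multiple of `hⁱ`
  have key : ∀ i : ℕ, 0 < i → C.ch X (L.foldr (· ⊞ ·) 0) i =
      ((Lp.map fun E => C.ch X E i).sum - (Lm.map fun F => C.ch X F i).sum) +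
        (((Lm.map fun F => r F i).sum : ℚ) : ℂ) • Literature.AlgebraicGeometry.HodgeTheory.cupPowTwo h i := by
    intro i hi
    rw [C.ch_foldr_biprod hZ i L hLf, C.ch_eq_zero_of_isZero (isZero_zero _), add_zero, hL,
      List.map_append, List.sum_append, List.map_map]
    have hsum : ((Lm.map ((fun E => C.ch X E i) ∘ K))).sum =
        (Lm.map fun F => ((r F i : ℚ) : ℂ) • Literature.AlgebraicGeometry.HodgeTheory.cupPowTwo h i).sum -
          (Lm.map fun F => C.ch X F i).sum := by
      rw [eq_sub_iff_add_eq, ← List.sum_map_add]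
      refine congrArg List.sum (List.map_congr_left fun F hF => ?_)
      rw [Function.comp_apply, add_comm, hr F hF i hi]
    rw [hsum, Rat.cast_list_sum, List.map_map, List.sum_smul, List.map_map]
    have : (Lm.map ((fun r : ℂ => r • Literature.AlgebraicGeometry.HodgeTheory.cupPowTwo h i) ∘
        (Rat.cast ∘ fun F => r F i))) =
        Lm.map fun F => ((r F i : ℚ) : ℂ) • Literature.AlgebraicGeometry.HodgeTheory.cupPowTwo h i := rfl
    rw [this]
    abel
  refine ⟨L.foldr (· ⊞ ·) 0, Literature.AlgebraicGeometry.HodgeTheory.isFiniteLocallyFree_foldr_biprod hZ L hLf,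
    q + (Lm.map fun F => r F p).sum, N, fun i => c i + (Lm.map fun F => r F i).sum, hN, ?_, ?_⟩
  · -- degree `p`
    rw [key p hp, hchp, Rat.cast_add, add_smul]
    abel
  · -- degrees `0 < i < p`
    intro i hi hip
    rw [key i hi, hchi i hi hip, Rat.cast_add, add_smul]

end Summit.HodgeConjecture.HodgeConjecture.Theorems.KleimanChernCharacterOnBettiBirth

end
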